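import Summits.CriticalPhenomena.PercolationContinuityZ3.Theorems.PercNonProliferationSubpolynomialBlockingTwoSidedChargingCorollaries
import HarnessLib

/-!
# `SubpolynomialBlocking`, line `SketchIdeator5` (two-sided charging) — the composition, in the tree

Support file for crux item stmt-CriticalPhenomena-4446 (`PercNonProliferation.SubpolynomialBlocking`), lead a1. With the
four landed stubs of the line (`stub_productFloor` p128649, `stub_inArm_le_halfSpaceReach` p128568,
`stub_outArm_le_siteToBoundary` p128630, `stub_floorOfArmRates` p128825) this file lands the line's COMPOSITION
(the skeleton's `SubpolynomialBlocking_of` with every provable stub discharged):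

* `critBlockProb_ge_exp_neg_two_charge` — **the floor in charge form, unconditionally**: eventually in `n`,
  `exp(-2·charge_{p_c}(n)) ≤ u_n`, `charge_{p_c}(n) = Σ_{v ∈ ∂ⁱⁿΛ_m} P_{p_c}(inArm v n) P_{p_c}(outArm v n)`, `m = n + ⌊n/2⌋`
  (every `P(inArm) ≤ h'_{⌊n/2⌋} → 0` by Barsky–Grimmett–Newman, and `1 - x ≥ e^{-2x}` on `[0, 1/2]`);
* `subpolynomialBlocking_of_chargeSubLog` — **the residual stub implies the crux**: if the critical two-sided charge
  is `o(log n)` (the registered `stub_chargeSubLog`, verbatim as hypothesis) then `SubpolynomialBlocking`.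

Together with `critCharge_ge` (`charge ≥ c`) this is the complete logical content of the line: the crux would follow from
`charge = o(log n)`, the tree certifies `c ≤ charge ≤ 96 n² h'_{⌊n/2⌋} = o(n²)`, and the residual is a numerical
question about one named quantity (heuristically `≍ n^{2 - x_s - x_b} ≈ n^{0.545}`, i.e. the residual is expected FALSE
— the line is a floor mechanism, not a proof of the crux).
-/

noncomputable section

namespace Summit.CriticalPhenomena.PercolationContinuityZ3.Theorems.SubpolynomialBlocking

open MeasureTheory Filter Topology
open Literature.Probability.Percolation Literature.Probability.LatticeModels
open Literature.Probability.Percolation.DCT16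
open Literature.Probability.Percolation.CerfDembinVanishing
open Literature.Barriers.CriticalPhenomena
open Summit.CriticalPhenomena.PercolationContinuityZ3.Theorems.SubpolynomialBlocking.Negative

/-- **The two-sided charging floor in charge form, at `p_c(ℤ³)`**: eventually in `n`,
`exp(-2 · Σ_{v ∈ ∂ⁱⁿΛ_m} P(inArm v n) P(outArm v n)) ≤ u_n`. From `stub_productFloor` (`u_n ≥ ∏_v (1 - h_v g_v)`),
`stub_inArm_le_halfSpaceReach` + `FloorOfArmRates.tendsto_halfSpaceReach_half` (every `h_v ≤ 1/2` eventually, BGN) and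
`Nicolas.exp_neg_two_mul_le` (`e^{-2x} ≤ 1 - x` on `[0, 1/2]`). -/
theorem critBlockProb_ge_exp_neg_two_charge :
    ∀ᶠ n : ℕ in atTop,
      Real.exp (-(2 * ∑ v ∈ innerBoundary (zdGraph 3) (box 3 (n + n / 2)),
          (bondPercolation (zdGraph 3) (criticalProbI 3)).real
              {ω | ∃ x ∈ box 3 n, ω ∈ openConnIn (↑(box 3 (n + n / 2)) : Set (Site 3)) v x} *
            (bondPercolation (zdGraph 3) (criticalProbI 3)).real
              {ω | ∃ y ∈ innerBoundary (zdGraph 3) (box 3 (2 * n)),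
                ω ∈ openConnIn (↑(box 3 (2 * n)) : Set (Site 3)) v y})) ≤
        blockProb 3 (criticalProbI 3) n := by
  have hev : ∀ᶠ n : ℕ in atTop,
      (bondPercolation (zdGraph 3) (criticalProbI 3)).real (halfSpaceReach 3 (n / 2)) < 1 / 2 :=
    FloorOfArmRates.tendsto_halfSpaceReach_half.eventually (gt_mem_nhds (by norm_num))
  filter_upwards [hev, eventually_ge_atTop 1] with n hn hn1
  refine le_trans ?_ (stub_productFloor (criticalProbI 3) n hn1)
  rw [Finset.mul_sum, ← Finset.sum_neg_distrib, Real.exp_sum]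
  refine Finset.prod_le_prod (fun v _ => (Real.exp_pos _).le) fun v hv => ?_
  refine Literature.NumberTheory.LFunctions.Nicolas.exp_neg_two_mul_le
    (mul_nonneg measureReal_nonneg measureReal_nonneg) ?_
  have h1 : (bondPercolation (zdGraph 3) (criticalProbI 3)).real
      {ω | ∃ x ∈ box 3 n, ω ∈ openConnIn (↑(box 3 (n + n / 2)) : Set (Site 3)) v x} ≤ 1 / 2 :=
    (stub_inArm_le_halfSpaceReach (criticalProbI 3) n v hv).trans hn.le
  calc (bondPercolation (zdGraph 3) (criticalProbI 3)).real
          {ω | ∃ x ∈ box 3 n, ω ∈ openConnIn (↑(box 3 (n + n / 2)) : Set (Site 3)) v x} *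
        (bondPercolation (zdGraph 3) (criticalProbI 3)).real
          {ω | ∃ y ∈ innerBoundary (zdGraph 3) (box 3 (2 * n)),
            ω ∈ openConnIn (↑(box 3 (2 * n)) : Set (Site 3)) v y} ≤ 1 / 2 * 1 :=
        mul_le_mul h1 measureReal_le_one measureReal_nonneg (by norm_num)
    _ = 1 / 2 := by norm_num

/-- **THE LINE'S COMPOSITION: the residual stub implies the crux** (registered on stmt-CriticalPhenomena-4446 as
`subpolynomialBlocking_of_chargeSubLog`). If the critical two-sided charge is `o(log n)` — the registered residual
`stub_chargeSubLog` of line `SketchIdeator5`, verbatim — then `PercNonProliferation.SubpolynomialBlocking`: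
`n^{-s} = exp(-s log n) ≤ exp(-2·charge) ≤ u_n` once `charge ≤ (s/2) log n` (`critBlockProb_ge_exp_neg_two_charge`).
The hypothesis is EXPECTED FALSE (charge `≍ n^{0.545}` heuristically; `≥ c` rigorously, `critCharge_ge`): this theorem
records the logical structure of the line, not progress on the crux. -/
theorem subpolynomialBlocking_of_chargeSubLog :
    (∀ s : ℝ, 0 < s → ∀ᶠ n : ℕ in atTop,
      (∑ v ∈ innerBoundary (zdGraph 3) (box 3 (n + n / 2)),
          (bondPercolation (zdGraph 3) (criticalProbI 3)).real
              {ω | ∃ x ∈ box 3 n, ω ∈ openConnIn (↑(box 3 (n + n / 2)) : Set (Site 3)) v x} *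
            (bondPercolation (zdGraph 3) (criticalProbI 3)).real
              {ω | ∃ y ∈ innerBoundary (zdGraph 3) (box 3 (2 * n)),
                ω ∈ openConnIn (↑(box 3 (2 * n)) : Set (Site 3)) v y}) ≤ s * Real.log n) →
      Summit.CriticalPhenomena.PercolationContinuityZ3.Theses.PercNonProliferation.SubpolynomialBlocking := by
  intro hch
  refine Negative.crux_iff.2 fun s hs => ?_
  have hch' := hch (s / 2) (by positivity)
  filter_upwards [critBlockProb_ge_exp_neg_two_charge, hch', eventually_ge_atTop 1] with n hfloor hcharge hn1
  refine le_trans ?_ hfloor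
  have hn0 : (0 : ℝ) < n := by exact_mod_cast hn1
  rw [Real.rpow_def_of_pos hn0, Real.exp_le_exp]
  nlinarith

end Summit.CriticalPhenomena.PercolationContinuityZ3.Theorems.SubpolynomialBlocking

end
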